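import Summits.Ventures.Crystal3D.Kissing125.GSearchCheck2
import Summits.Ventures.Crystal3D.Kissing125.GSearchDefs3
import Summits.Ventures.Crystal3D.Kissing125.GSearchSearch2
import HarnessLib

/-!
# Soundness of bisection and of the search, κ-generic — part 3/3

HONEST FRAMING (cell pub-crystal3d, K-path at `h = 5/4`, V4 = κ as an explicit parameter): this is NOT a result printed
by Hales; it is his METHOD (arXiv:1209.6043, Theorem 3 + Lemmas 7–10, in the tree's form of a verified interval-arithmetic
growth search, `Literature/…/KissingSearch*.lean`) with the largest long-side cosine `κ` made an EXPLICIT PARAMETER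
(`κ : Kappa`, carrying the two numeric facts the soundness proof uses: `-1/2 ≤ κ`, `κ < 1/4`).  Only the declarations
whose statement depends on `κ` are declared here (namespace `…Kissing125.GSearch`, the tree's short names, no renames);
every κ-free helper is the landed K25 copy (`…Kissing125.KissingSearch.*`) and every κ-free lemma is cited from the tree
(PRIVATE per-file citation aliases; `GSearchTransport.lean` holds `toT : St → tree St` and the transport equalities).  The K25
instance is `κ25 = ⟨7/32, …⟩`; `GSearchBridge.lean` identifies the generic checker at
`κ25` with the landed `Kissing125.KissingSearch.checkPart`, so the landed run files are consumed unchanged.  Generated by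
`HOME/lean/kissing125/v4-prep/gen/mkgen.py`; nothing here is asserted about GAP(1.26) or any census.

THIS FILE: the κ-tainted declarations of `Literature/Geometry/DiscreteGeometry/KissingSearchSearch.lean` (part 3 of 3), with `κ : Kappa` threaded; κ-free declarations of that file are NOT re-declared publicly (the κ-free helpers are the landed K25 copies; the κ-free tree lemmas used by the proofs are cited through PRIVATE aliases at the top of the file).

## References
* T. C. Hales, *A proof of Fejes Tóth's conjecture on sphere packings with kissing number twelve*,
  arXiv:1209.6043 (2012): Definition 1, Theorem 2, Theorem 3, Lemmas 7–10. [`Hales2012`]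
* R. E. Moore, *Interval Analysis* (1966), Theorem 3.1, §4.4. [`Moore1966`]
-/

namespace Summit.Ventures.Crystal3D.Kissing125

open Literature.Geometry.DiscreteGeometry
open Summit.Ventures.Crystal3D.Kissing125.KissingSearch

namespace GSearch

open Real Literature.Analysis.ValidatedNumerics KissingLP NonemptyInterval Finset

variable {κ : Kappa}

/-! ### κ-free tree lemmas used below, read over the K25 copies (PRIVATE citation aliases; the public
surface of this file is κ-generic only) -/

/-- K25 reading of the tree lemma `mem_indexed_of_mem` (κ-free; proof = citation of the tree lemma). [folklore] -/
private theorem mem_indexed_of_mem {α : Type} {L : List α} {x : α} (h : x ∈ L) :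
  ∃ j, (j, x) ∈ indexed L :=
  Literature.Geometry.DiscreteGeometry.KissingSearch.mem_indexed_of_mem h

/-- K25 reading of the tree lemma `mem_kidsAt` (κ-free; proof = verbatim 4-line copy of the tree proof — the statement lives in `Option`/`List` of the K25 `St`, not transportable by citation). [folklore] -/
private theorem mem_kidsAt {s s' : St} {v a c r1 r2 : ℕ}
  (hadd : s.addTri v a c = some s') (h1 : r1 ∈ s.labelOpts v c) (h2 : r2 ∈ s.labelOpts a c)
  (hk : ((s'.sdom v c r1).sdom a c r2).countKill v a c = false) :
  ((s'.sdom v c r1).sdom a c r2, [v, a, c]) ∈ s.kidsAt v a c :=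
  by
  unfold St.kidsAt
  rw [hadd]
  simp only [List.mem_flatMap, List.mem_filterMap]
  exact ⟨r1, h1, r2, h2, by rw [hk]; simp⟩

/-- K25 reading of the tree lemma `newLabel_none` (κ-free; proof = citation of the tree lemma). [folklore] -/
private theorem newLabel_none {s : St} (h : s.newLabel = none) {n : ℕ}
  (hn : n < 12) : s.hdeg2 n ≠ 0 :=
  by rw [hdeg2_tr]; exact Literature.Geometry.DiscreteGeometry.KissingSearch.newLabel_none (s := toT s) (by rw [← newLabel_tr]; exact h) hn

/-- K25 reading of the tree lemma `newLabel_some` (κ-free; proof = citation of the tree lemma). [folklore] -/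
private theorem newLabel_some {s : St} {n : ℕ} (h : s.newLabel = some n) :
  n < 12 ∧ s.hdeg2 n = 0 :=
  by rw [hdeg2_tr]; exact Literature.Geometry.DiscreteGeometry.KissingSearch.newLabel_some (s := toT s) (by rw [← newLabel_tr]; exact h)


section Search
/-- **Soundness of the search.**  If `s.search dirty fuel = true` for a state realized by a
structure `M` satisfying the root normalisation, in which the labels `0, …, 4` are used, then
the contact graph of `M` is FCC or HCP. [cite: Hales2012, Theorem 3 and Lemma 9] -/
theorem search_sound : ∀ (fuel : ℕ) (M : KConf κ) (s : St) (dirty : List ℕ), Realizes M s → M.RootInv →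
    (∀ x, x < 5 → ∃ t ∈ s.tris.toList, x ∈ tset t) → St.search κ s dirty fuel = true → M.Concl
  | 0, M, s, dirty, _, _, _, h => by unfold St.search at h; cases h
  | fuel + 1, M, s, dirty, hR, hI, hU5, h => by
    classical
    unfold St.search at h
    revert h
    unfold St.expand
    obtain ⟨n1, k1⟩ := propagateWL_sound 400 dirty s hR
    cases hp : St.propagateWL κ s 400 dirty with
    | none => exact absurd hp n1
    | some s₁ =>
      obtain ⟨hR1, htr1⟩ := k1 s₁ hp
      have hU5' : ∀ x, x < 5 → ∃ t ∈ s₁.tris.toList, x ∈ tset t := by rw [htr1]; exact hU5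
      have hne1 : s₁.tris.toList ≠ [] := by
        obtain ⟨t, ht, -⟩ := hU5' 0 (by norm_num)
        exact List.ne_nil_of_mem ht
      simp only [rootKill_false hR1 hI, Bool.false_eq_true, ↓reduceIte]
      cases hco : s₁.chooseOpen with
      | none =>
        simp only
        have hno : ∀ v, v < 12 → ∀ a, a < 12 → a ≠ v → s₁.gsc v a ≠ 1 :=
          fun v hv a ha hav => chooseOpen_none hR1 hco hv ha hav
        have hall : ∀ t'' ∈ M.T, ∃ t ∈ s₁.tris.toList, tset t = t'' := fun t'' hT => all_placed_of_no_open hR1 hno hne1 hT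
        obtain ⟨hsz, hnu⟩ := size_and_nused_of_complete hR1 hall
        simp only [hsz, hnu, bne_self_eq_false, Bool.or_self, Bool.false_eq_true, ↓reduceIte]
        by_cases hacc : s₁.accept = true
        · intro _; exact accept_sound hR1 hall hacc
        · simp only [hacc, Bool.false_eq_true, ↓reduceIte]
          intro h; exact (refute_sound 40 s₁ hR1 h).elim
      | some p =>
        obtain ⟨v, a, b⟩ := p
        simp only
        obtain ⟨hv, ha, hav, h1, t₀, ht₀, hset₀, hb, hbv, hba⟩ := chooseOpen_some hR1 hco
        obtain ⟨c, hc, hcv, hca, hcb, hT, hun⟩ := exists_third hR1 hv ha hav h1 ht₀ hset₀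
        have hsz : ¬ 20 ≤ s₁.tris.size := not_le.2 (size_lt_of_unplaced hR1 hT hun)
        rw [if_neg hsz]
        simp only [List.all_eq_true, List.mem_append, List.mem_flatMap, List.mem_filter, List.mem_range, Bool.not_eq_true',
          Bool.or_eq_false_iff, beq_eq_false_iff_ne, ne_eq, decide_eq_false_iff_not, not_le]
        intro hkids
        have hlab : s₁.gdom v a ≠ UNL :=
          hR1.side_lab t₀ ht₀ v (by rw [hset₀]; simp) a (by rw [hset₀]; simp) (Ne.symm hav)
        -- the growth step at an admissible third vertex `c'` in a structure `M'` realizing `s₁`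
        have grow : ∀ (M' : KConf κ) (c' : ℕ), Realizes M' s₁ → M'.RootInv → c' < 12 → c' ≠ v → c' ≠ a →
            ({v, a, c'} : Finset ℕ) ∈ M'.T → (∀ t ∈ s₁.tris.toList, tset t ≠ {v, a, c'}) →
            (∀ q ∈ s₁.kidsAt v a c', St.search κ q.1 q.2 fuel = true) → M'.Concl := by
          intro M' c' hR' hI' hc' hc'v hc'a hT' hun' hstep
          obtain ⟨s', hadd, hR'', htris', -, -⟩ := realizes_grow hR' hv ha hc' (Ne.symm hav) (Ne.symm hc'v) (Ne.symm hc'a)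
            hT' hun' hlab
          have m1 := trueCode_mem_labelOpts hR' hv hc' (Ne.symm hc'v) hT' (by simp) (by simp)
          have m2 := trueCode_mem_labelOpts hR' ha hc' (Ne.symm hc'a) hT' (by simp) (by simp)
          have hk := countKill_false hR'' hI' hv ha hc'
          have h := hstep _ (mem_kidsAt hadd m1 m2 hk)
          exact search_sound fuel M' _ [v, a, c'] hR'' hI' (fun x hx => by
            obtain ⟨t, ht, hxt⟩ := hU5' x hx
            exact ⟨t, by simp [htris', ht], hxt⟩) h
        by_cases hused : s₁.hdeg2 c = 0
        · -- `c` unused: relabel through the smallest unused label `n`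
          cases hnl : s₁.newLabel with
          | none => exact absurd hused (newLabel_none hnl hc)
          | some n =>
            obtain ⟨hn, hn0⟩ := newLabel_some hnl
            have hcu : ∀ t ∈ s₁.tris.toList, c ∉ tset t := fun t ht hct =>
              (used_iff_hdeg2 hR1 hc).1 ⟨t, ht, hct⟩ hused
            have hnu : ∀ t ∈ s₁.tris.toList, n ∉ tset t := fun t ht hnt =>
              (used_iff_hdeg2 hR1 hn).1 ⟨t, ht, hnt⟩ hn0
            have hc5 : 5 ≤ c := by
              by_contra h; push Not at h
              obtain ⟨t, ht, hct⟩ := hU5' c h; exact hcu t ht hct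
            have hn5 : 5 ≤ n := by
              by_contra h; push Not at h
              obtain ⟨t, ht, hnt⟩ := hU5' n h; exact hnu t ht hnt
            have hvu : ∃ t ∈ s₁.tris.toList, v ∈ tset t := ⟨t₀, ht₀, by rw [hset₀]; simp⟩
            have hau : ∃ t ∈ s₁.tris.toList, a ∈ tset t := ⟨t₀, ht₀, by rw [hset₀]; simp⟩
            have hnv : n ≠ v := by rintro rfl; obtain ⟨t, ht, h⟩ := hvu; exact hnu t ht h
            have hna : n ≠ a := by rintro rfl; obtain ⟨t, ht, h⟩ := hau; exact hnu t ht h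
            have hσ : ∀ x, (Equiv.swap c n) x < 12 ↔ x < 12 := by
              intro x
              by_cases e1 : x = c
              · subst e1; rw [Equiv.swap_apply_left]; exact ⟨fun _ => hc, fun _ => hn⟩
              · by_cases e2 : x = n
                · subst e2; rw [Equiv.swap_apply_right]; exact ⟨fun _ => hn, fun _ => hc⟩
                · rw [Equiv.swap_apply_of_ne_of_ne e1 e2]
            have hR' : Realizes (M.relabel (Equiv.swap c n) hσ) s₁ := realizes_swap hR1 hc hn hcu hnu
            have hI' := rootInv_relabel_swap M hc5 hn5 hσ hI
            refine KConf.concl_of_relabel M _ hσ (grow _ n hR' hI' hn hnv hna ?_ ?_ fun q hq => hkids q (Or.inr ?_))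
            · show ({v, a, n} : Finset ℕ) ∈ M.T.image (relab (Equiv.swap c n))
              rw [Finset.mem_image]
              refine ⟨{v, a, c}, hT, ?_⟩
              unfold relab
              have e1 : (Equiv.swap c n) v = v := Equiv.swap_apply_of_ne_of_ne (Ne.symm hcv) (Ne.symm hnv)
              have e2 : (Equiv.swap c n) a = a := Equiv.swap_apply_of_ne_of_ne (Ne.symm hca) (Ne.symm hna)
              have e3 : (Equiv.swap c n) c = n := Equiv.swap_apply_left _ _
              simp [Finset.image_insert, Finset.image_singleton, e1, e2, e3]
            · intro t ht e
              exact hnu t ht (by rw [e]; simp)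
            · rw [hnl]; exact hq
        · -- `c` used: the old-label branch
          have g1 : s₁.gsc v c < 2 := by
            by_contra h2; push Not at h2
            have h2' : s₁.gsc v c = 2 := le_antisymm (gsc_le_two hR1 hv hc (Ne.symm hcv)) h2
            obtain ⟨t, ht, e⟩ := placed_of_gsc_two hR1 hv hc (Ne.symm hcv) h2' hT (by simp) (by simp)
            exact hun t ht e
          have g2 : s₁.gsc a c < 2 := by
            by_contra h2; push Not at h2
            have h2' : s₁.gsc a c = 2 := le_antisymm (gsc_le_two hR1 ha hc (Ne.symm hca)) h2
            obtain ⟨t, ht, e⟩ := placed_of_gsc_two hR1 ha hc (Ne.symm hca) h2' hT (by simp) (by simp)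
            exact hun t ht e
          exact grow M c hR1 hI hc hcv hca hT hun fun q hq =>
            hkids q (Or.inl ⟨c, ⟨hc, ⟨⟨⟨⟨hcv, hca⟩, hcb⟩, hused⟩, g1⟩, g2⟩, hq⟩)

/-! ### Part D. Frontiers and parts -/

/-- **One level**: if every node of `stepAll L` searches `true` with fuel `f`, every node of
`L` searches `true` with fuel `f + 1`. [folklore] -/
theorem stepAll_sound : ∀ (L L' : List (St × List ℕ)) (f : ℕ), stepAll κ L = some L' →
    (∀ q ∈ L', St.search κ q.1 q.2 f = true) → ∀ p ∈ L, St.search κ p.1 p.2 (f + 1) = true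
  | [], L', f, _, _ => by simp
  | p :: rest, L', f, h, hL' => by
    intro q hq
    unfold stepAll at h
    rcases List.mem_cons.1 hq with rfl | hq
    · -- the head
      unfold St.search
      revert h
      cases he : St.expand κ q.1 q.2 with
      | leaf b =>
        cases b
        · intro h; cases h
        · intro _; rfl
      | branch kids =>
        intro h
        simp only
        rw [List.all_eq_true]
        intro k hk
        revert h
        cases hs : stepAll κ rest with
        | none => intro h; cases h
        | some L'' =>
          intro h
          simp only [Option.map_some, Option.some.injEq] at h
          exact hL' k (by rw [← h]; exact List.mem_append_left _ hk)
    · -- the tail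
      revert h
      cases he : St.expand κ p.1 p.2 with
      | leaf b =>
        cases b
        · intro h; cases h
        · intro h; exact stepAll_sound rest L' f h hL' q hq
      | branch kids =>
        cases hs : stepAll κ rest with
        | none => intro h; cases h
        | some L'' =>
          intro h
          simp only [Option.map_some, Option.some.injEq] at h
          exact stepAll_sound rest L'' f hs (fun r hr => hL' r (by rw [← h]; exact List.mem_append_right _ hr)) q hq

/-- **Frontiers**: if every node of the frontier at depth `k` searches `true` with fuel `f`,
every start node searches `true` with fuel `f + k`. [folklore] -/
theorem frontier_sound : ∀ (k : ℕ) (L L' : List (St × List ℕ)) (f : ℕ), frontier κ L k = some L' →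
    (∀ q ∈ L', St.search κ q.1 q.2 f = true) → ∀ p ∈ L, St.search κ p.1 p.2 (f + k) = true
  | 0, L, L', f, h, hL' => by
    unfold frontier at h
    cases h
    simpa using hL'
  | k + 1, L, L', f, h, hL' => by
    unfold frontier at h
    revert h
    cases hs : stepAll κ L with
    | none => intro h; cases h
    | some L₁ =>
      intro h
      have h1 := frontier_sound k L₁ L' f h hL'
      have := stepAll_sound L L₁ (f + k) hs h1
      rwa [show f + (k + 1) = f + k + 1 by omega]

/-- **All parts together decide every root.** [folklore] -/
theorem search_roots_of_parts {depth parts fuel : ℕ} (hparts : 0 < parts)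
    (h : ∀ i, i < parts → checkPart κ depth parts i fuel = true) :
    ∀ p ∈ rootStates, St.search κ p.1 p.2 (fuel + depth) = true := by
  have h0 := h 0 hparts
  unfold checkPart at h0
  revert h0
  cases hf : frontier κ rootStates depth with
  | none => intro h0; cases h0
  | some L =>
    intro _
    refine frontier_sound depth rootStates L fuel hf fun q hq => ?_
    obtain ⟨j, hj⟩ := mem_indexed_of_mem hq
    have hi := h (j % parts) (Nat.mod_lt _ hparts)
    unfold checkPart at hi
    rw [hf] at hi
    simp only [List.all_eq_true] at hi
    have := hi (j, q) hj
    simpa using this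

end Search


end GSearch

end Summit.Ventures.Crystal3D.Kissing125
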